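import Summits.QuantumFields.BalabanUV.T4Continuum.Support.NE7FrameDefectLipschitzRadius
import HarnessLib

/-!
# NE7SliceLimitLPShape — THE ROAD's (LP′) IN THE DISPLAYED SHAPE `hLP` OF `NE7SliceLimitNLR.limitNLR_of_geometric(_reg)` ∕ `NE7SliceTangentPartLimitNLR.limitNLR_of_rate`: on the sup-ball of
# radius `b₀` the frame defect `P(X) = mlog v_{k+1}(X) − framePotW X` is Lipschitz in the form `‖X − X′‖ ≤ bX ⟹ ‖P(X) z − P(X′) z‖ ≤ K_P·bX`, `K_P = 4·C_Γ·(L^{k+1})²·b₁`, for any regime radius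
# `b₁ ≥ 6 b₀` (junction piece for t4-ne7-p1's `NE7SliceTheoremNL`; companion of the v2 append p776110)

Cell `pub-balaban`, rung (B)+1 sub-cell t4, lineage `b2b-balaban-t4-ne7b-p1`, generation 152 (OWNER of BINDER row NE7b; junction service for the NE crew, ruling R-OWNER-149-1 (2)).
The one-call limit theorems of this lineage (`NE7SliceLimitNLR`, gen 151∕152) DISPLAY the road's Lipschitz letter as `hLP : ∀ X X′ bX, sup‖X‖ ≤ b₀ → sup‖X′‖ ≤ b₀ → 0 ≤ bX →
(∀ y κ, ‖X y κ − X′ y κ‖ ≤ bX) → ∀ z, ‖P(X) z − P(X′) z‖ ≤ K_P·bX` with a free `K_P ≥ 0`.  t4-ne7-p1 g103's (LP′) `NE7FrameDefectLipschitzRadius.norm_frameDefect_sub_frameDefect_le_of_radius`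
gives `‖P(X′) z − P(X) z‖ ≤ 4C_Γ(L^{k+1})²b₁·δ` for `sup‖X‖ ≤ b`, `sup‖X′ − X‖ ≤ δ`, `2(b + δ) ≤ b₁`, B7's Prop-4 regime at `b₁`.  This file is the two-line junction: take `b := b₀`,
`δ := min bX (2b₀)` (two fields of sup `≤ b₀` differ by at most `2b₀`), so `2(b + δ) ≤ 6b₀ ≤ b₁` and `4C_Γ(L^{k+1})²b₁·δ ≤ K_P·bX`.
WHAT ([folklore]; 0 def, 0 sorry).  `lpConst_nonneg` (`0 ≤ K_P`), **`lp_shape_of_radius`** (exactly the `hLP` binder, regime hypotheses of (LP′) displayed verbatim, plus `0 ≤ b₀`, `6·b₀ ≤ b₁`).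
HONEST FRAMING (page 1): arithmetic over the road's (LP′); nothing of Bałaban's asserted; NOT the (S1)-NL assembly, NOT (S2), NOT NE7, nothing of row NE7b; spine 0∕9; finite T⁴ rung (B)+1 — NOT
infinite volume, NOT mass gap, NOT BetaPertH, NOT Clay.  Continuum YM on T⁴ ⇐ BetaPertH ∧ nine spine estimates (0/9 proved); BetaPertH ⇐ (D1) ∧ (D4) ∧ CAP+tail; G-an2-4 gates asym, D1
and NE2/3/4.
-/

set_option autoImplicit false

open scoped BigOperators Matrix Matrix.Norms.L2Operator
open NormedSpace Finset

namespace Summit.QuantumFields.BalabanUV.T4Continuum.NE7SliceLimitLPShape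

open Literature.MathematicalPhysics.QuantumFieldTheory.Balaban1983to89
open B7Prop1Explicit B7Prop2Explicit B7Prop3Flat MatrixLog
open B7Eq92Concrete (vcov)
open T4AveragingDeficitWall (IsUnitaryCfg SmallField)
open AveragingDeficitMultiLevelPrep (LevelSmall)
open NE3TangentCovariantTower (framePotW)
open NE3.PairLandauB8Avg (relPert)
open NE7FrameDefectLipschitzRadius (norm_frameDefect_sub_frameDefect_le_of_radius)

noncomputable section

variable {d : ℕ} {n : Type*} [Fintype n] [DecidableEq n]

/-- `0 ≤ K_P = 4·C_Γ·(L^{k+1})²·b₁` for `b₁ ≥ 0`. [folklore] -/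
theorem lpConst_nonneg (L k : ℕ) {b₁ : ℝ} (hb₁ : 0 ≤ b₁) :
    0 ≤ 4 * (56 * ((d : ℝ) * L) ^ 2 + 16 * (131072 * ((d : ℝ) + 1) ^ 2) * ((d : ℝ) * L)) * ((L : ℝ) ^ (k + 1)) ^ 2 * b₁ := by
  positivity

section Shape

variable [Nonempty n] {L : ℕ} (hL : 2 ≤ L) (k : ℕ) {W : Site d → Fin d → (Matrix n n ℂ)ˣ} (hWu : IsUnitaryCfg W)
  {α₀ : ℝ} (hα : 0 < α₀) (hα3 : C0 d * α₀ ≤ 1 / 3) (hα4 : 4 * α₀ ≤ c2' d L) (h52 : pdev W < α₀ * (((L : ℝ) ^ (k + 1))⁻¹) ^ 2)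
  (κ₀ : Fin d) {x : ℝ} (hx : 0 ≤ x) (hs : LevelSmall d L k x) (hWx : SmallField W x)
  {b₀ b₁ : ℝ} (hb₀ : 0 ≤ b₀) (h6 : 6 * b₀ ≤ b₁)
  (hsmall : Real.exp (4 * (800 * ((d : ℝ) + 1) ^ 2 * ((d : ℝ) + 4)) * α₀)
    * (1 + 8 * (131072 * ((d : ℝ) + 1) ^ 2) * ((L : ℝ) ^ (k + 1) * b₁)) ≤ 2)
  (hc₃ : 2 * ((L : ℝ) ^ (k + 1) * b₁) ≤ c3 d L) (h100 : 100 * ((d : ℝ) * L * ((L : ℝ) ^ (k + 1) * b₁)) ≤ 1)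
  (hC16 : 16 * (131072 * ((d : ℝ) + 1) ^ 2) * ((L : ℝ) ^ (k + 1) * b₁) ≤ 1) (hsm : 2048 * (d : ℝ) * ((L : ℝ) ^ (k + 1) * b₁) ≤ 1)

include hL hWu hα hα3 hα4 h52 κ₀ hx hs hWx hb₀ h6 hsmall hc₃ h100 hC16 hsm in
/-- **(LP′) IN THE `hLP` SHAPE**: multi-level small-field class at `W`, B7's Prop-4 regime at a radius `b₁ ≥ 6b₀`: for all fields `X, X′` of sup `≤ b₀` and every `bX ≥ 0` with
`‖X y κ − X′ y κ‖ ≤ bX`: `‖P(X) z − P(X′) z‖ ≤ (4·C_Γ·(L^{k+1})²·b₁)·bX`, `P(X) z = mlog v_{k+1}(X)(z) − framePotW L (k+1) W X z`, `C_Γ = 56(dL)² + 16C₁dL`.  Feed it as `hLP` (and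
`lpConst_nonneg` as `hKP`) to `NE7SliceLimitNLR.limitNLR_of_geometric_reg`. [folklore] -/
theorem lp_shape_of_radius :
    ∀ (X X' : Site d → Fin d → Matrix n n ℂ) (bX : ℝ), (∀ y κ, ‖X y κ‖ ≤ b₀) → (∀ y κ, ‖X' y κ‖ ≤ b₀) → 0 ≤ bX →
      (∀ y κ, ‖X y κ - X' y κ‖ ≤ bX) → ∀ z : Site d,
        ‖(mlog ((vcov L W (relPert W X) (k + 1) z : (Matrix n n ℂ)ˣ) : Matrix n n ℂ) - framePotW L (k + 1) W X z)
            - (mlog ((vcov L W (relPert W X') (k + 1) z : (Matrix n n ℂ)ˣ) : Matrix n n ℂ) - framePotW L (k + 1) W X' z)‖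
          ≤ 4 * (56 * ((d : ℝ) * L) ^ 2 + 16 * (131072 * ((d : ℝ) + 1) ^ 2) * ((d : ℝ) * L)) * ((L : ℝ) ^ (k + 1)) ^ 2 * b₁ * bX := by
  intro X X' bX hX hX' hbX hD z
  -- the effective displacement bound `δ := min bX (2 b₀)`
  have hδ0 : 0 ≤ min bX (2 * b₀) := le_min hbX (by linarith)
  have hD' : ∀ y κ, ‖X' y κ - X y κ‖ ≤ min bX (2 * b₀) := fun y κ => by
    refine le_min ?_ ?_
    · rw [norm_sub_rev]; exact hD y κ
    · calc ‖X' y κ - X y κ‖ ≤ ‖X' y κ‖ + ‖X y κ‖ := norm_sub_le _ _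
        _ ≤ b₀ + b₀ := add_le_add (hX' y κ) (hX y κ)
        _ = 2 * b₀ := by ring
  have hb₁ : 2 * (b₀ + min bX (2 * b₀)) ≤ b₁ := by
    have := min_le_right bX (2 * b₀); linarith
  have h := norm_frameDefect_sub_frameDefect_le_of_radius hL k hWu hα hα3 hα4 h52 κ₀ hx hs hWx hb₀ hδ0 hX hD' hb₁ hsmall hc₃ h100 hC16 hsm z
  rw [norm_sub_rev] at h
  have hK : 0 ≤ 4 * (56 * ((d : ℝ) * L) ^ 2 + 16 * (131072 * ((d : ℝ) + 1) ^ 2) * ((d : ℝ) * L)) * ((L : ℝ) ^ (k + 1)) ^ 2 * b₁ :=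
    lpConst_nonneg (d := d) L k (by linarith)
  exact h.trans (mul_le_mul_of_nonneg_left (min_le_left _ _) hK)

end Shape

end

end Summit.QuantumFields.BalabanUV.T4Continuum.NE7SliceLimitLPShape
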